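import Summits.KontsevichZagierPeriods.KontsevichZagierPeriods.Theorems.BiellipticRealPeriodCell.Negative.Witnesses

/-!
# `BiellipticRealPeriodCell` (stmt-KontsevichZagierPeriods-18685) — negative knowledge, part 4: the lemniscatic witness

Support file for the crux `IsogenyCertificates.BiellipticRealPeriodCell` (cdisprove seat, cycle 1;
work file `Cruxes/BiellipticRealPeriodCell/Disproof.lean`, finding F6). A second witness curve, chosen
so that the relevant period is one whose transcendence the tree KNOWS: the bielliptic genus-2 curve
`y² = F₁(x) = (x²−1)(x²−25)(x²−49) = G₁(x²)`, `G₁(u) = (u−1)(u−25)(u−49)`. Its roots `1, 25, 49` are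
SQUARES IN ARITHMETIC PROGRESSION, so the odd elliptic quotient `E₁ : y² = G₁(u)` is the quadratic
twist by `24` of the lemniscatic curve `y² = x³ − x` (`G₁(24X+25) = 24³(X³ − X)`), while the sextic
keeps six RATIONAL Weierstrass points `±1, ±5, ±7`. The positivity set `{F₁ > 0}` has the bounded
off-zero components `K₊ = (1,5)` (through `3`) and `K₋ = (−5,−1)` (through `−3`) (§14, via the
tree's `component_eq_of_Ioo`). This file shows that the ODD sector generators `[K₊, x/√F₁]`,
`[K₋, x/√F₁]` (`a₀ = 0`, `a₁ = 1`) exist (§15: `G₁` is a cubic and `F₁` is squarefree, §13;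
semialgebraicity; absolute integrability by the model domination on intervals of length `≥ 1`,
`inv_sqrt_le_model_of_le`) and that their values are `V` and `−V`, `V := ∫₁⁵ x dx/√F₁` (odd integrand,
even sextic: one reflection). Part 5 (`LemniscaticValue`) computes `V = ϖ/(2√24)` and concludes.
No statement of the tree is changed and no definition is introduced (the cubic and the sextic are
written out; the witnesses are existence theorems). [Kontsevich–Zagier 2001, §1.1] [folklore]
-/

noncomputable section

open Set MeasureTheory MvPolynomial
open Literature.NumberTheory.Transcendental Literature.ModelTheory.ExponentialFields
open Summit.KontsevichZagierPeriods.KontsevichZagierPeriods.Theses.IsogenyCertificates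
open Summit.KontsevichZagierPeriods.HermiteRigidity.GenusTwoCycleTransferNegative
  (integrableOn_model integrableOn_fin_one setIntegral_fin_one)
open Summit.KontsevichZagierPeriods.IsogenyCertificates.EffectiveXMapChainsLine.PieceOntoComponent
  (component_eq_of_Ioo)

namespace Summit.KontsevichZagierPeriods.IsogenyCertificates.BiellipticRealPeriodCellNegative

/-! ### §13 The lemniscatic bielliptic curve `y² = (x²−1)(x²−25)(x²−49)` -/

/-- `G₁ = u³ − 75u² + 1299u − 1225 = (u−1)(u−25)(u−49)` is a cubic. [folklore] -/
theorem natDegree_G₁ : (Polynomial.C 1 * Polynomial.X ^ 3 + Polynomial.C (-75) * Polynomial.X ^ 2 +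
    Polynomial.C 1299 * Polynomial.X + Polynomial.C (-1225) : Polynomial ℚ).natDegree = 3 :=
  Polynomial.natDegree_cubic (by norm_num)

/-- The sextic `F₁ = G₁(x²) = (x²−1)(x²−25)(x²−49)` as a real function. [folklore] -/
theorem aeval_F₁ (y : ℝ) : Polynomial.aeval y ((Polynomial.C 1 * Polynomial.X ^ 3 + Polynomial.C (-75) * Polynomial.X ^ 2 +
    Polynomial.C 1299 * Polynomial.X + Polynomial.C (-1225) : Polynomial ℚ).comp (Polynomial.X ^ 2)) =
    (y ^ 2 - 1) * (y ^ 2 - 25) * (y ^ 2 - 49) := by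
  simp only [Polynomial.aeval_comp, map_add, map_mul, Polynomial.aeval_C, Polynomial.aeval_X,
    map_pow, map_neg, map_one, eq_ratCast]
  push_cast
  ring

/-- `F₁` factors over `ℚ` into six distinct linear factors (roots `±1, ±5, ±7`). [folklore] -/
theorem comp_G₁_eq_prod : ((Polynomial.C 1 * Polynomial.X ^ 3 + Polynomial.C (-75) * Polynomial.X ^ 2 +
    Polynomial.C 1299 * Polynomial.X + Polynomial.C (-1225) : Polynomial ℚ).comp (Polynomial.X ^ 2)) =
    ∏ i : Fin 6, (Polynomial.X - Polynomial.C ((![1, -1, 5, -5, 7, -7] : Fin 6 → ℚ) i)) := by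
  simp only [Polynomial.add_comp, Polynomial.mul_comp, Polynomial.C_comp, Polynomial.X_pow_comp,
    Polynomial.X_comp, Fin.prod_univ_six]
  have e0 : (![1, -1, 5, -5, 7, -7] : Fin 6 → ℚ) 0 = 1 := rfl
  have e1 : (![1, -1, 5, -5, 7, -7] : Fin 6 → ℚ) 1 = -1 := rfl
  have e2 : (![1, -1, 5, -5, 7, -7] : Fin 6 → ℚ) 2 = 5 := rfl
  have e3 : (![1, -1, 5, -5, 7, -7] : Fin 6 → ℚ) 3 = -5 := rfl
  have e4 : (![1, -1, 5, -5, 7, -7] : Fin 6 → ℚ) 4 = 7 := rfl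
  have e5 : (![1, -1, 5, -5, 7, -7] : Fin 6 → ℚ) 5 = -7 := rfl
  simp only [e0, e1, e2, e3, e4, e5, map_neg, map_one]
  have h5 : (Polynomial.C (5 : ℚ)) = 5 := rfl
  have h7 : (Polynomial.C (7 : ℚ)) = 7 := rfl
  have h75 : (Polynomial.C (75 : ℚ)) = 75 := rfl
  have h1299 : (Polynomial.C (1299 : ℚ)) = 1299 := rfl
  have h1225 : (Polynomial.C (1225 : ℚ)) = 1225 := rfl
  rw [h5, h7, h75, h1299, h1225]
  ring

/-- `F₁` is squarefree. [folklore] -/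
theorem squarefree_comp_G₁ : Squarefree ((Polynomial.C 1 * Polynomial.X ^ 3 + Polynomial.C (-75) * Polynomial.X ^ 2 +
    Polynomial.C 1299 * Polynomial.X + Polynomial.C (-1225) : Polynomial ℚ).comp (Polynomial.X ^ 2)) := by
  rw [comp_G₁_eq_prod]
  have hsep : (∏ i : Fin 6, (Polynomial.X - Polynomial.C ((![1, -1, 5, -5, 7, -7] : Fin 6 → ℚ) i))).Separable := by
    rw [Polynomial.separable_prod_X_sub_C_iff']
    decide
  exact hsep.squarefree

/-- The lemniscatic sextic is even. [folklore] -/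
theorem lemSextic_even (x : ℝ) :
    ((-x) ^ 2 - 1) * ((-x) ^ 2 - 25) * ((-x) ^ 2 - 49) = (x ^ 2 - 1) * (x ^ 2 - 25) * (x ^ 2 - 49) := by ring

/-! ### §14 Signs, domination and the components `K₊ = (1,5)`, `K₋ = (−5,−1)` -/

/-- On `K₊ = (1,5)`: `(x−1)(5−x) ≤ F₁(x)` (the cofactor `(x+1)(x+5)(49−x²)` is `≥ 288`). [folklore] -/
theorem lemSextic_ge {x : ℝ} (hx : x ∈ Ioo (1:ℝ) 5) :
    (x - 1) * (5 - x) ≤ (x ^ 2 - 1) * (x ^ 2 - 25) * (x ^ 2 - 49) := by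
  have h1 : 0 < x - 1 := by linarith [hx.1]
  have h2 : 0 < 5 - x := by linarith [hx.2]
  have h3 : (2:ℝ) ≤ x + 1 := by linarith [hx.1]
  have h4 : (6:ℝ) ≤ x + 5 := by linarith [hx.1]
  have h5 : (24:ℝ) ≤ 49 - x ^ 2 := by nlinarith [hx.1, hx.2]
  have hab : (2:ℝ) * 6 ≤ (x + 1) * (x + 5) := mul_le_mul h3 h4 (by norm_num) (by linarith)
  have habc : (2:ℝ) * 6 * 24 ≤ (x + 1) * (x + 5) * (49 - x ^ 2) := mul_le_mul hab h5 (by norm_num) (by nlinarith)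
  have key : (x ^ 2 - 1) * (x ^ 2 - 25) * (x ^ 2 - 49) = (x - 1) * (5 - x) * ((x + 1) * (x + 5) * (49 - x ^ 2)) := by ring
  rw [key]
  have hpos : 0 ≤ (x - 1) * (5 - x) := le_of_lt (mul_pos h1 h2)
  calc (x - 1) * (5 - x) = (x - 1) * (5 - x) * 1 := by ring
    _ ≤ (x - 1) * (5 - x) * ((x + 1) * (x + 5) * (49 - x ^ 2)) := mul_le_mul_of_nonneg_left (by linarith) hpos

/-- `F₁ > 0` on `K₊ = (1,5)`. [folklore] -/
theorem lemSextic_pos {x : ℝ} (hx : x ∈ Ioo (1:ℝ) 5) : 0 < (x ^ 2 - 1) * (x ^ 2 - 25) * (x ^ 2 - 49) :=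
  lt_of_lt_of_le (mul_pos (by linarith [hx.1]) (by linarith [hx.2])) (lemSextic_ge hx)

/-- `F₁ > 0` on `K₋ = (−5,−1)` (evenness). [folklore] -/
theorem lemSextic_pos_neg {x : ℝ} (hx : x ∈ Ioo (-5:ℝ) (-1)) : 0 < (x ^ 2 - 1) * (x ^ 2 - 25) * (x ^ 2 - 49) := by
  have h := lemSextic_pos (x := -x) ⟨by linarith [hx.2], by linarith [hx.1]⟩
  rwa [lemSextic_even] at h

/-- General-length model domination: on `(a,b)` with `1 ≤ b − a`, `(x−a)(b−x) ≤ F` gives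
`1/√F ≤ (√(x−a))⁻¹ + (√(b−x))⁻¹` (square `1 ≤ b − a ≤ (√(x−a) + √(b−x))²`). [folklore] -/
theorem inv_sqrt_le_model_of_le {x a b : ℝ} (hba : 1 ≤ b - a) (hx : x ∈ Ioo a b) {F : ℝ}
    (hF : (x - a) * (b - x) ≤ F) : 1 / Real.sqrt F ≤ (Real.sqrt (x - a))⁻¹ + (Real.sqrt (b - x))⁻¹ := by
  have hs : 0 < x - a := by linarith [hx.1]
  have ht : 0 < b - x := by linarith [hx.2]
  have h0 : 0 < Real.sqrt (x - a) := Real.sqrt_pos.mpr hs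
  have h1 : 0 < Real.sqrt (b - x) := Real.sqrt_pos.mpr ht
  have hs0 : Real.sqrt (x - a) ^ 2 = x - a := Real.sq_sqrt hs.le
  have hs1 : Real.sqrt (b - x) ^ 2 = b - x := Real.sq_sqrt ht.le
  have hpos : 0 < (x - a) * (b - x) := mul_pos hs ht
  have hle : 1 / Real.sqrt F ≤ 1 / Real.sqrt ((x - a) * (b - x)) :=
    one_div_le_one_div_of_le (Real.sqrt_pos.mpr hpos) (Real.sqrt_le_sqrt hF)
  refine hle.trans ?_
  rw [Real.sqrt_mul hs.le, one_div, inv_le_iff_one_le_mul₀ (mul_pos h0 h1)]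
  have key : 1 ≤ Real.sqrt (x - a) + Real.sqrt (b - x) := by nlinarith [mul_pos h0 h1]
  calc (1 : ℝ) ≤ Real.sqrt (x - a) + Real.sqrt (b - x) := key
    _ = ((Real.sqrt (x - a))⁻¹ + (Real.sqrt (b - x))⁻¹) * (Real.sqrt (x - a) * Real.sqrt (b - x)) := by
        field_simp; ring

/-- The positivity set of the lemniscatic sextic, in coordinates. [folklore] -/
theorem lemPosSet_eq : {y : ℝ | 0 < Polynomial.aeval y ((Polynomial.C 1 * Polynomial.X ^ 3 + Polynomial.C (-75) * Polynomial.X ^ 2 +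
    Polynomial.C 1299 * Polynomial.X + Polynomial.C (-1225) : Polynomial ℚ).comp (Polynomial.X ^ 2))} =
    {y : ℝ | 0 < (y ^ 2 - 1) * (y ^ 2 - 25) * (y ^ 2 - 49)} := by
  ext y; simp only [mem_setOf_eq, aeval_F₁]

/-- The component through `3` is `K₊ = (1,5)`. [folklore] -/
theorem lemComponent_right : connectedComponentIn {y : ℝ | 0 < Polynomial.aeval y ((Polynomial.C 1 * Polynomial.X ^ 3 +
    Polynomial.C (-75) * Polynomial.X ^ 2 + Polynomial.C 1299 * Polynomial.X + Polynomial.C (-1225) : Polynomial ℚ).comp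
    (Polynomial.X ^ 2))} (((3 : ℚ) : ℝ)) = Ioo 1 5 := by
  rw [lemPosSet_eq]
  refine component_eq_of_Ioo ?_ ?_ (fun x hx => lemSextic_pos hx) ⟨by norm_num, by norm_num⟩
  · simp only [mem_setOf_eq]; norm_num
  · simp only [mem_setOf_eq]; norm_num

/-- The component through `−3` is `K₋ = (−5,−1)`. [folklore] -/
theorem lemComponent_left : connectedComponentIn {y : ℝ | 0 < Polynomial.aeval y ((Polynomial.C 1 * Polynomial.X ^ 3 +
    Polynomial.C (-75) * Polynomial.X ^ 2 + Polynomial.C 1299 * Polynomial.X + Polynomial.C (-1225) : Polynomial ℚ).comp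
    (Polynomial.X ^ 2))} (((-3 : ℚ) : ℝ)) = Ioo (-5) (-1) := by
  rw [lemPosSet_eq]
  refine component_eq_of_Ioo ?_ ?_ (fun x hx => lemSextic_pos_neg hx) ⟨by norm_num, by norm_num⟩
  · simp only [mem_setOf_eq]; norm_num
  · simp only [mem_setOf_eq]; norm_num

/-! ### §15 The odd generators `[K±, x/√F₁]` exist; their values -/

/-- `x/√F₁` is a `ℚ`-semialgebraic function where `F₁ > 0`. [cite: BochnakCosteRoy1998, Prop. 2.2.6] -/
theorem lemXInvSqrt_semialgebraic {σ : Set (Fin 1 → ℝ)} (hσ : IsSemialgebraic ℚ σ)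
    (hf : ∀ p ∈ σ, 0 < (p 0 ^ 2 - 1) * (p 0 ^ 2 - 25) * (p 0 ^ 2 - 49)) :
    IsSemialgebraicFunOn ℚ σ (fun p => p 0 / Real.sqrt ((p 0 ^ 2 - 1) * (p 0 ^ 2 - 25) * (p 0 ^ 2 - 49))) := by
  have h1 := isSemialgebraicFunOn_aeval_div_aeval hσ (1 : MvPolynomial (Fin 1) ℚ)
    ((X 0 ^ 2 - 1) * (X 0 ^ 2 - 25) * (X 0 ^ 2 - 49)) (fun p hp => by simpa using (hf p hp).ne')
  have h2 : IsSemialgebraicFunOn ℚ σ (fun p => 1 / ((p 0 ^ 2 - 1) * (p 0 ^ 2 - 25) * (p 0 ^ 2 - 49))) :=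
    h1.congr (fun p _ => by simp)
  have h3 : IsSemialgebraicFunOn ℚ σ (fun p => 1 / Real.sqrt ((p 0 ^ 2 - 1) * (p 0 ^ 2 - 25) * (p 0 ^ 2 - 49))) :=
    (h2.fun_sqrt).congr (fun p _ => by simp only [one_div, Real.sqrt_inv])
  refine ((Literature.NumberTheory.Transcendental.isSemialgebraicFunOn_apply hσ 0).fun_mul h3).congr (fun p _ => ?_)
  simp only [mul_one_div]

/-- `x/√F₁` is Borel measurable. [folklore] -/
theorem measurable_lemXInvSqrt : Measurable (fun x : ℝ => x / Real.sqrt ((x ^ 2 - 1) * (x ^ 2 - 25) * (x ^ 2 - 49))) := by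
  fun_prop

/-- `x/√F₁` is integrable on `K₊ = (1,5)` (`|x| ≤ 5`, model domination). [folklore] -/
theorem integrableOn_lemXInvSqrt_right :
    IntegrableOn (fun x : ℝ => x / Real.sqrt ((x ^ 2 - 1) * (x ^ 2 - 25) * (x ^ 2 - 49))) (Ioo 1 5) := by
  refine Integrable.mono' ((integrableOn_model 1 5).const_mul 5) measurable_lemXInvSqrt.aestronglyMeasurable ?_
  filter_upwards [ae_restrict_mem measurableSet_Ioo] with x hx
  have hs : 0 < Real.sqrt ((x ^ 2 - 1) * (x ^ 2 - 25) * (x ^ 2 - 49)) := Real.sqrt_pos.mpr (lemSextic_pos hx)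
  rw [norm_div, Real.norm_of_nonneg hs.le, Real.norm_eq_abs, abs_of_pos (by linarith [hx.1])]
  have hmodel := inv_sqrt_le_model_of_le (by norm_num) hx (lemSextic_ge hx)
  have hnn : 0 ≤ (Real.sqrt (x - 1))⁻¹ + (Real.sqrt (5 - x))⁻¹ := by positivity
  calc x / Real.sqrt ((x ^ 2 - 1) * (x ^ 2 - 25) * (x ^ 2 - 49))
      = x * (1 / Real.sqrt ((x ^ 2 - 1) * (x ^ 2 - 25) * (x ^ 2 - 49))) := by rw [mul_one_div]
    _ ≤ 5 * ((Real.sqrt (x - 1))⁻¹ + (Real.sqrt (5 - x))⁻¹) :=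
        mul_le_mul (le_of_lt hx.2) hmodel (by positivity) (by norm_num)

/-- `x/√F₁` is integrable on `K₋ = (−5,−1)` (reflection of the previous bound). [folklore] -/
theorem integrableOn_lemXInvSqrt_left :
    IntegrableOn (fun x : ℝ => x / Real.sqrt ((x ^ 2 - 1) * (x ^ 2 - 25) * (x ^ 2 - 49))) (Ioo (-5) (-1)) := by
  refine Integrable.mono' ((integrableOn_model (-5) (-1)).const_mul 5) measurable_lemXInvSqrt.aestronglyMeasurable ?_
  filter_upwards [ae_restrict_mem measurableSet_Ioo] with x hx
  have hx' : -x ∈ Ioo (1:ℝ) 5 := ⟨by linarith [hx.2], by linarith [hx.1]⟩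
  have hs : 0 < Real.sqrt ((x ^ 2 - 1) * (x ^ 2 - 25) * (x ^ 2 - 49)) := Real.sqrt_pos.mpr (lemSextic_pos_neg hx)
  rw [norm_div, Real.norm_of_nonneg hs.le, Real.norm_eq_abs, abs_of_neg (by linarith [hx.2])]
  have hF : (x - (-5)) * (-1 - x) ≤ (x ^ 2 - 1) * (x ^ 2 - 25) * (x ^ 2 - 49) := by
    have h := lemSextic_ge hx'
    rw [lemSextic_even] at h
    calc (x - (-5)) * (-1 - x) = (-x - 1) * (5 - -x) := by ring
      _ ≤ _ := h
  have hmodel := inv_sqrt_le_model_of_le (by norm_num) hx hF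
  calc -x / Real.sqrt ((x ^ 2 - 1) * (x ^ 2 - 25) * (x ^ 2 - 49))
      = -x * (1 / Real.sqrt ((x ^ 2 - 1) * (x ^ 2 - 25) * (x ^ 2 - 49))) := by rw [mul_one_div]
    _ ≤ 5 * ((Real.sqrt (x - (-5)))⁻¹ + (Real.sqrt (-1 - x))⁻¹) :=
        mul_le_mul (by linarith [hx.1]) hmodel (by positivity) (by norm_num)

/-- **`[K₊, x/√F₁]` exists** as an honest representation. [cite: KontsevichZagier2001, §1.1] -/
theorem exists_lemRepRight : ∃ r : KZ.IntegralRep 1, r.domain = {p | p 0 ∈ Ioo (1:ℝ) 5} ∧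
    r.integrand = (fun p => p 0 / Real.sqrt ((p 0 ^ 2 - 1) * (p 0 ^ 2 - 25) * (p 0 ^ 2 - 49))) := by
  have hσ : IsSemialgebraic ℚ {p : Fin 1 → ℝ | p 0 ∈ Ioo (1:ℝ) 5} := by
    have h := isSemialgebraic_Ioo_fin_one 1 5; norm_num at h; exact h
  exact ⟨⟨{p | p 0 ∈ Ioo (1:ℝ) 5}, fun p => p 0 / Real.sqrt ((p 0 ^ 2 - 1) * (p 0 ^ 2 - 25) * (p 0 ^ 2 - 49)), hσ,
    lemXInvSqrt_semialgebraic hσ fun _ hp => lemSextic_pos hp,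
    integrableOn_fin_one (S := Ioo 1 5)
      (g := fun x => x / Real.sqrt ((x ^ 2 - 1) * (x ^ 2 - 25) * (x ^ 2 - 49))) integrableOn_lemXInvSqrt_right⟩,
    rfl, rfl⟩

/-- **`[K₋, x/√F₁]` exists** as an honest representation. [cite: KontsevichZagier2001, §1.1] -/
theorem exists_lemRepLeft : ∃ r : KZ.IntegralRep 1, r.domain = {p | p 0 ∈ Ioo (-5:ℝ) (-1)} ∧
    r.integrand = (fun p => p 0 / Real.sqrt ((p 0 ^ 2 - 1) * (p 0 ^ 2 - 25) * (p 0 ^ 2 - 49))) := by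
  have hσ : IsSemialgebraic ℚ {p : Fin 1 → ℝ | p 0 ∈ Ioo (-5:ℝ) (-1)} := by
    have h := isSemialgebraic_Ioo_fin_one (-5) (-1); norm_num at h; exact h
  exact ⟨⟨{p | p 0 ∈ Ioo (-5:ℝ) (-1)}, fun p => p 0 / Real.sqrt ((p 0 ^ 2 - 1) * (p 0 ^ 2 - 25) * (p 0 ^ 2 - 49)), hσ,
    lemXInvSqrt_semialgebraic hσ fun _ hp => lemSextic_pos_neg hp,
    integrableOn_fin_one (S := Ioo (-5) (-1))
      (g := fun x => x / Real.sqrt ((x ^ 2 - 1) * (x ^ 2 - 25) * (x ^ 2 - 49))) integrableOn_lemXInvSqrt_left⟩,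
    rfl, rfl⟩

/-- **`∫₋₅⁻¹ x dx/√F₁ = −∫₁⁵ x dx/√F₁`** (odd integrand, reflect). [folklore] -/
theorem lemIntegral_left_eq_neg_right :
    ∫ x in Ioo (-5:ℝ) (-1), x / Real.sqrt ((x ^ 2 - 1) * (x ^ 2 - 25) * (x ^ 2 - 49)) =
      -∫ x in Ioo (1:ℝ) 5, x / Real.sqrt ((x ^ 2 - 1) * (x ^ 2 - 25) * (x ^ 2 - 49)) := by
  rw [← integral_Ioc_eq_integral_Ioo, ← integral_Ioc_eq_integral_Ioo,
    ← intervalIntegral.integral_of_le (by norm_num), ← intervalIntegral.integral_of_le (by norm_num)]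
  have h := intervalIntegral.integral_comp_neg (a := (1:ℝ)) (b := 5)
    (fun x : ℝ => x / Real.sqrt ((x ^ 2 - 1) * (x ^ 2 - 25) * (x ^ 2 - 49)))
  simp only [lemSextic_even, neg_div, intervalIntegral.integral_neg] at h
  rw [← h]

/-- Values of the two odd generators: `value r₊ = V := ∫₁⁵ x dx/√F₁`, `value r₋ = −V`. [folklore] -/
theorem lemValue_right {r : KZ.IntegralRep 1} (hd : r.domain = {p | p 0 ∈ Ioo (1:ℝ) 5})
    (hi : r.integrand = fun p => p 0 / Real.sqrt ((p 0 ^ 2 - 1) * (p 0 ^ 2 - 25) * (p 0 ^ 2 - 49))) :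
    r.value = ∫ x in Ioo (1:ℝ) 5, x / Real.sqrt ((x ^ 2 - 1) * (x ^ 2 - 25) * (x ^ 2 - 49)) :=
  value_eq_of_eq (g := fun x => x / Real.sqrt ((x ^ 2 - 1) * (x ^ 2 - 25) * (x ^ 2 - 49))) hd hi

/-- `value r₋ = −V`. [folklore] -/
theorem lemValue_left {r : KZ.IntegralRep 1} (hd : r.domain = {p | p 0 ∈ Ioo (-5:ℝ) (-1)})
    (hi : r.integrand = fun p => p 0 / Real.sqrt ((p 0 ^ 2 - 1) * (p 0 ^ 2 - 25) * (p 0 ^ 2 - 49))) :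
    r.value = -∫ x in Ioo (1:ℝ) 5, x / Real.sqrt ((x ^ 2 - 1) * (x ^ 2 - 25) * (x ^ 2 - 49)) :=
  (value_eq_of_eq (g := fun x => x / Real.sqrt ((x ^ 2 - 1) * (x ^ 2 - 25) * (x ^ 2 - 49))) hd hi).trans
    lemIntegral_left_eq_neg_right

end Summit.KontsevichZagierPeriods.IsogenyCertificates.BiellipticRealPeriodCellNegative
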